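import Mathlib
import Summits.Langlands.Langlands.Theorems.PhantomRMYoshidaStableYoshidaCongruenceOrdinaryFrameFpOrientation
import Literature.NumberTheory.GaloisRepresentations.SerreWeightShapeProofs
import HarnessLib

/-!
# Route `PhantomRMYoshida`, crux `StableYoshidaCongruence` (stmt-Langlands-13640), line
# `burkhardt-weddle-two-three-anchor`: support for Stub 5 `stub_ordinaryFrameFp`, II (descent)

Pure linear algebra used by `stub_ordinaryFrameFp` (file `…OrdinaryFrameFp.lean`), all proved:

* `exists_frame_of_plane`: for a plane `U ⊆ F⁴`, a `g ∈ GL₄(F)` (inverse of a basis matrix extending a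
  basis of `U`) in which every `X` with `X U ⊆ U` is block upper triangular, with upper-left block `1`
  when `X|_U = 1` and lower-right block the scalar `c` when `X ≡ c mod U`;
* `mul_sub_det_smul_one_eq_zero`: `N (G - det G) = 0` for `2 × 2` matrices with `N w = 0`, `G w = w`,
  `w ≠ 0` (the inertia shape `[[1,*],[0,ε̄⁻¹]]` of an ordinary block);
* `frame_descent`: if `A : Γ → GL₄(F)` becomes, over an extension `f : F → E`, conjugate to a block
  sum `S 0 ⊕ S 1` of `Γ → GL₂(E)` whose blocks satisfy the four "line" hypotheses at some `τ₀`
  (one-dimensional kernel of `S i τ₀ - 1`, stable, inertia-fixed, scalar quotient), then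
  `U := ker (A τ₀ - 1) ⊆ F⁴` is a plane giving an ordinary frame of `A` OVER `F` (kernels commute with
  change of coefficients and conjugation: file `…OrdinaryFrameFpOrientation.lean`).

No definitions; no named fact is used.  Worker of lead prover-line-stmt-Langlands-13640-c1-0
(2026-08-16).
-/

-- `Summit.Langlands.Langlands.…` (summit = sub-problem name, D-0017 layout) trips `dupNamespace`.
set_option linter.dupNamespace false

noncomputable section

open Module Matrix
open Literature.NumberTheory.GaloisRepresentations

namespace Summit.Langlands.Langlands.Cruxes.StableYoshidaCongruence.BurkhardtWeddleTwoThreeAnchor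

/-! ## Frames adapted to a plane in `F⁴` -/

section Frame

variable {F : Type*} [Field F]

/-- A basis of `F⁴` whose first two vectors span a given plane `U`: the vectors of index `< 2` lie in
`U` and the last two coordinates of every element of `U` vanish. [folklore] -/
theorem exists_basis_adapted_plane (U : Submodule F (Fin 4 → F)) (hU : finrank F U = 2) :
    ∃ b : Module.Basis (Fin 4) F (Fin 4 → F),
      (∀ j : Fin 4, (j : ℕ) < 2 → b j ∈ U) ∧
        ∀ x ∈ U, ∀ i : Fin 4, 2 ≤ (i : ℕ) → b.repr x i = 0 := by
  obtain ⟨U', hc⟩ := U.exists_isCompl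
  have hU' : finrank F U' = 2 := by
    have h := Submodule.finrank_add_eq_of_isCompl hc
    rw [Module.finrank_fin_fun] at h
    omega
  let e : (U × U') ≃ₗ[F] (Fin 4 → F) := Submodule.prodEquivOfIsCompl U U' hc
  let b₀ : Module.Basis (Fin 2 ⊕ Fin 2) F (Fin 4 → F) :=
    ((Module.finBasisOfFinrankEq F U hU).prod (Module.finBasisOfFinrankEq F U' hU')).map e
  let e4 : Fin 2 ⊕ Fin 2 ≃ Fin 4 := finSumFinEquiv
  refine ⟨b₀.reindex e4, fun j hj => ?_, fun x hx i hi => ?_⟩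
  · have hj' : j = e4 (Sum.inl (⟨j, hj⟩ : Fin 2)) :=
      Fin.ext (show (j : ℕ) = (Fin.castAdd 2 (⟨j, hj⟩ : Fin 2) : ℕ) by simp)
    rw [hj', Module.Basis.reindex_apply, Equiv.symm_apply_apply]
    simp [b₀, e]
  · have hi' : i = e4 (Sum.inr (⟨i - 2, by omega⟩ : Fin 2)) :=
      Fin.ext (show (i : ℕ) = (Fin.natAdd 2 (⟨i - 2, by omega⟩ : Fin 2) : ℕ) by simp; omega)
    rw [hi', Module.Basis.repr_reindex_apply, Equiv.symm_apply_apply]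
    simp [b₀, e, Submodule.prodEquivOfIsCompl_symm_apply_left U U' hc ⟨x, hx⟩]

/-- **Frames adapted to a plane.**  For a plane `U ⊆ F⁴` there is `g ∈ GL₄(F)` (the inverse of a
basis matrix extending a basis of `U`) such that, for every `X ∈ M₄(F)`: if `X U ⊆ U` the lower-left
`2 × 2` block of `g X g⁻¹` vanishes; if `X` is the identity on `U` the upper-left block is `1`; if
`X ≡ c` modulo `U` the lower-right block is the scalar `c`. [folklore] -/
theorem exists_frame_of_plane (U : Submodule F (Fin 4 → F)) (hU : finrank F U = 2) :
    ∃ g : GL (Fin 4) F,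
      (∀ X : Matrix (Fin 4) (Fin 4) F, (∀ u ∈ U, X *ᵥ u ∈ U) →
        ∀ i j : Fin 4, 2 ≤ (i : ℕ) → (j : ℕ) < 2 →
          (g.val * X * (g⁻¹).val) i j = 0) ∧
      (∀ X : Matrix (Fin 4) (Fin 4) F, (∀ u ∈ U, X *ᵥ u = u) →
        ∀ i j : Fin 4, (i : ℕ) < 2 → (j : ℕ) < 2 →
          (g.val * X * (g⁻¹).val) i j = if i = j then 1 else 0) ∧
      (∀ (X : Matrix (Fin 4) (Fin 4) F) (c : F), (∀ x, X *ᵥ x - c • x ∈ U) →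
        ∀ i j : Fin 4, 2 ≤ (i : ℕ) → 2 ≤ (j : ℕ) →
          (g.val * X * (g⁻¹).val) i j = if i = j then c else 0) := by
  obtain ⟨b, hbU, hbrepr⟩ := exists_basis_adapted_plane U hU
  have hPP' : (Pi.basisFun F (Fin 4)).toMatrix b * b.toMatrix (Pi.basisFun F (Fin 4)) = 1 :=
    (Pi.basisFun F (Fin 4)).toMatrix_mul_toMatrix_flip b
  have hP'P : b.toMatrix (Pi.basisFun F (Fin 4)) * (Pi.basisFun F (Fin 4)).toMatrix b = 1 :=
    b.toMatrix_mul_toMatrix_flip (Pi.basisFun F (Fin 4))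
  let g : GL (Fin 4) F :=
    ⟨b.toMatrix (Pi.basisFun F (Fin 4)), (Pi.basisFun F (Fin 4)).toMatrix b, hP'P, hPP'⟩
  have hentry : ∀ (X : Matrix (Fin 4) (Fin 4) F) (i j : Fin 4),
      (g.val * X * (g⁻¹).val) i j = b.repr (X *ᵥ b j) i := by
    intro X i j
    have h := basis_toMatrix_mul_linearMap_toMatrix_mul_basis_toMatrix b (Pi.basisFun F (Fin 4)) b
      (Pi.basisFun F (Fin 4)) (Matrix.toLin' X)
    rw [LinearMap.toMatrix_eq_toMatrix', LinearMap.toMatrix'_toLin'] at h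
    change (b.toMatrix (Pi.basisFun F (Fin 4)) * X * (Pi.basisFun F (Fin 4)).toMatrix b) i j = _
    rw [h, LinearMap.toMatrix_apply, Matrix.toLin'_apply]
  refine ⟨g, fun X hX i j hi hj => ?_, fun X hX i j hi hj => ?_, fun X c hX i j hi hj => ?_⟩
  · rw [hentry]
    exact hbrepr _ (hX _ (hbU j hj)) i hi
  · rw [hentry, hX _ (hbU j hj), b.repr_self, Finsupp.single_apply]
    by_cases h : i = j
    · subst h; simp
    · rw [if_neg (Ne.symm h), if_neg h]
  · rw [hentry, show X *ᵥ b j = (X *ᵥ b j - c • b j) + c • b j from (sub_add_cancel _ _).symm]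
    rw [map_add, map_smul, Finsupp.add_apply, hbrepr _ (hX _) i hi, zero_add, b.repr_self,
      Finsupp.smul_apply, Finsupp.single_apply]
    by_cases h : i = j
    · subst h; simp
    · rw [if_neg (Ne.symm h), if_neg h, smul_zero]

end Frame

/-! ## A `2 × 2` identity -/

section TwoByTwo

variable {E : Type*} [Field E]

/-- If `N w = 0` and `G w = w` for some `w ≠ 0` in `E²`, then `N (G - det G) = 0`: in a basis
starting with `w`, `N = [[0,*],[0,*]]` and `G - det G = [[1 - det G, *],[0, 0]]`. [folklore] -/
theorem mul_sub_det_smul_one_eq_zero {N G : Matrix (Fin 2) (Fin 2) E} {w : Fin 2 → E}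
    (hw : w ≠ 0) (hN : N *ᵥ w = 0) (hG : G *ᵥ w = w) :
    N * (G - G.det • (1 : Matrix (Fin 2) (Fin 2) E)) = 0 := by
  obtain ⟨Q, hQ⟩ := ModPGaloisRep.InertiaShape.exists_gl_mulVec_single_zero_eq w hw
  have hN' := ModPGaloisRep.InertiaShape.conj_mulVec_single_zero (M := N) (c := 0) hQ
    (by rw [hN, zero_smul])
  have hG' := ModPGaloisRep.InertiaShape.conj_mulVec_single_zero (M := G) (c := 1) hQ
    (by rw [hG, one_smul])
  set N' := ((Q⁻¹ : GL (Fin 2) E) : Matrix (Fin 2) (Fin 2) E) * N *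
    (Q : Matrix (Fin 2) (Fin 2) E) with hN'def
  set G' := ((Q⁻¹ : GL (Fin 2) E) : Matrix (Fin 2) (Fin 2) E) * G *
    (Q : Matrix (Fin 2) (Fin 2) E) with hG'def
  have hN'0 : ∀ i, N' i 0 = 0 := fun i => by
    simpa using ModPGaloisRep.InertiaShape.apply_of_mulVec_single_eq_smul hN' i
  have hG'0 : ∀ i : Fin 2, G' i 0 = if i = 0 then 1 else 0 := fun i =>
    ModPGaloisRep.InertiaShape.apply_of_mulVec_single_eq_smul hG' i
  have hdet : G'.det = G.det := by
    rw [hG'def, Matrix.det_units_conj']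
  have hG'11 : G' 1 1 = G.det := by
    rw [← hdet, Matrix.det_fin_two, hG'0 0, hG'0 1]
    simp
  have key : N' * (G' - G.det • (1 : Matrix (Fin 2) (Fin 2) E)) = 0 := by
    ext i j
    fin_cases i <;> fin_cases j <;>
      simp [Matrix.mul_apply, Fin.sum_univ_two, hN'0, hG'0, hG'11, Matrix.one_apply]
  have h1 : (Q : Matrix (Fin 2) (Fin 2) E) * N' * ((Q⁻¹ : GL (Fin 2) E) : Matrix _ _ E) = N := by
    simp only [hN'def, Matrix.mul_assoc, Units.mul_inv, Matrix.mul_one, Units.mul_inv_cancel_left]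
  have h2 : (Q : Matrix (Fin 2) (Fin 2) E) * (G' - G.det • 1) *
      ((Q⁻¹ : GL (Fin 2) E) : Matrix _ _ E) = G - G.det • (1 : Matrix (Fin 2) (Fin 2) E) := by
    rw [Matrix.mul_sub, Matrix.sub_mul]
    congr 1
    · simp only [hG'def, Matrix.mul_assoc, Units.mul_inv, Matrix.mul_one,
        Units.mul_inv_cancel_left]
    · rw [Matrix.mul_smul, Matrix.mul_one, Matrix.smul_mul, Units.mul_inv]
  rw [← h1, ← h2]
  simp only [Matrix.mul_assoc]
  rw [Units.inv_mul_cancel_left, ← Matrix.mul_assoc N', key, Matrix.zero_mul, Matrix.mul_zero]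

end TwoByTwo

/-! ## Descent of an ordinary frame along a change of coefficients -/

section Descent

/-- **Descent of the ordinary frame.**  Let `f : F → E` be a field homomorphism, `A : Γ → GL₄(F)` a
homomorphism whose change of coefficients `A^f` is `GL₄(E)`-conjugate (by `h`) to a block sum
`S 0 ⊕ S 1` of two homomorphisms `S i : Γ → GL₂(E)`, `I ≤ Γ` a subgroup, `τ₀ ∈ Γ` and
`c : Γ → F`.  Suppose that for each block `Nᵢ := S i τ₀ - 1` has a one-dimensional kernel `ℓᵢ`,
stable under every `S i γ`, fixed pointwise by `S i τ` for `τ ∈ I`, and `Nᵢ (S i τ - f (c τ)) = 0`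
for `τ ∈ I` (i.e. `S i τ ≡ f (c τ)` modulo `ℓᵢ`).  Then `U := ker (A τ₀ - 1) ⊆ F⁴` is a plane
(kernels commute with change of coefficients and conjugation), stable under `A`, fixed by `A τ`,
`τ ∈ I`, with `A τ ≡ c τ` modulo `U`; so in a frame adapted to `U` (`exists_frame_of_plane`) `A` is
block upper triangular with `1` and the scalar `c τ` as diagonal blocks on `I`. [folklore] -/
theorem frame_descent :
    ∀ {F E : Type} [Field F] [Field E] {Γ : Type} [Group Γ] (f : F →+* E) (I : Subgroup Γ)
      (A : Γ →* GL (Fin 4) F) (S : Fin 2 → (Γ →* GL (Fin 2) E)) (h : GL (Fin 4) E),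
      (∀ γ, ((h⁻¹ * Matrix.GeneralLinearGroup.map f (A γ) * h : GL (Fin 4) E) :
          Matrix (Fin 4) (Fin 4) E) =
        Matrix.reindex finSumFinEquiv finSumFinEquiv
          (Matrix.fromBlocks ((S 0 γ : GL (Fin 2) E) : Matrix (Fin 2) (Fin 2) E) 0 0
            ((S 1 γ : GL (Fin 2) E) : Matrix (Fin 2) (Fin 2) E))) →
      ∀ (c : Γ → F) (τ₀ : Γ),
      (∀ i, Module.finrank E (LinearMap.ker
        (((S i τ₀ : GL (Fin 2) E) : Matrix (Fin 2) (Fin 2) E) - 1).mulVecLin) = 1) →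
      (∀ i γ,
        LinearMap.ker (((S i τ₀ : GL (Fin 2) E) : Matrix (Fin 2) (Fin 2) E) - 1).mulVecLin ≤
        LinearMap.ker ((((S i τ₀ : GL (Fin 2) E) : Matrix (Fin 2) (Fin 2) E) - 1) *
          ((S i γ : GL (Fin 2) E) : Matrix (Fin 2) (Fin 2) E)).mulVecLin) →
      (∀ i, ∀ τ ∈ I,
        LinearMap.ker (((S i τ₀ : GL (Fin 2) E) : Matrix (Fin 2) (Fin 2) E) - 1).mulVecLin ≤
          LinearMap.ker (((S i τ : GL (Fin 2) E) : Matrix (Fin 2) (Fin 2) E) - 1).mulVecLin) →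
      (∀ i, ∀ τ ∈ I,
        (((S i τ₀ : GL (Fin 2) E) : Matrix (Fin 2) (Fin 2) E) - 1) *
          (((S i τ : GL (Fin 2) E) : Matrix (Fin 2) (Fin 2) E) - f (c τ) • 1) = 0) →
      ∃ g : GL (Fin 4) F,
        (∀ (γ : Γ) (i j : Fin 4), 2 ≤ (i : ℕ) → (j : ℕ) < 2 →
          ((g * A γ * g⁻¹ : GL (Fin 4) F) : Matrix (Fin 4) (Fin 4) F) i j = 0) ∧
        (∀ τ ∈ I, ∀ i j : Fin 4, (i : ℕ) < 2 → (j : ℕ) < 2 →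
          ((g * A τ * g⁻¹ : GL (Fin 4) F) : Matrix (Fin 4) (Fin 4) F) i j =
            if i = j then 1 else 0) ∧
        (∀ τ ∈ I, ∀ i j : Fin 4, 2 ≤ (i : ℕ) → 2 ≤ (j : ℕ) →
          ((g * A τ * g⁻¹ : GL (Fin 4) F) : Matrix (Fin 4) (Fin 4) F) i j =
            if i = j then c τ else 0) := by
  intro F E _ _ Γ _ f I A S h hmodel c τ₀ hS1 hS2 hS3 hS4
  -- notation: `D γ = S 0 γ ⊕ S 1 γ`, `N i = S i τ₀ - 1`, `Dt = N 0 ⊕ N 1`,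
  -- `T₀ = A τ₀ - 1`
  set e : Fin 2 ⊕ Fin 2 ≃ Fin 4 := finSumFinEquiv with he
  set D : Γ → Matrix (Fin 4) (Fin 4) E := fun γ => Matrix.reindex e e
    (Matrix.fromBlocks ((S 0 γ : GL (Fin 2) E) : Matrix (Fin 2) (Fin 2) E) 0 0
      ((S 1 γ : GL (Fin 2) E) : Matrix (Fin 2) (Fin 2) E)) with hD
  set N : Fin 2 → Matrix (Fin 2) (Fin 2) E := fun i =>
    ((S i τ₀ : GL (Fin 2) E) : Matrix (Fin 2) (Fin 2) E) - 1 with hN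
  set Dt : Matrix (Fin 4) (Fin 4) E := Matrix.reindex e e (Matrix.fromBlocks (N 0) 0 0 (N 1))
    with hDt
  set T₀ : Matrix (Fin 4) (Fin 4) F := ((A τ₀ : GL (Fin 4) F) : Matrix (Fin 4) (Fin 4) F) - 1
    with hT₀
  have hval : ∀ γ, ((A γ : GL (Fin 4) F) : Matrix (Fin 4) (Fin 4) F).map f =
      ((Matrix.GeneralLinearGroup.map f (A γ) : GL (Fin 4) E) : Matrix (Fin 4) (Fin 4) E) :=
    fun γ => rfl
  have hB : ∀ γ, ((A γ : GL (Fin 4) F) : Matrix (Fin 4) (Fin 4) F).map f =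
      h.val * D γ * (h⁻¹).val := by
    intro γ
    have e1 : Matrix.GeneralLinearGroup.map f (A γ) =
        h * (h⁻¹ * Matrix.GeneralLinearGroup.map f (A γ) * h) * h⁻¹ := by group
    rw [hval, e1, Units.val_mul, Units.val_mul, hmodel γ]
  have hmulD : ∀ γ, Dt * D γ = Matrix.reindex e e (Matrix.fromBlocks
      (N 0 * ((S 0 γ : GL (Fin 2) E) : Matrix (Fin 2) (Fin 2) E)) 0 0
      (N 1 * ((S 1 γ : GL (Fin 2) E) : Matrix (Fin 2) (Fin 2) E))) := fun γ =>
    blockDiag_mul e _ _ _ _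
  have hsmulD : ∀ (γ : Γ) (a : E), D γ - a • 1 = Matrix.reindex e e (Matrix.fromBlocks
      (((S 0 γ : GL (Fin 2) E) : Matrix (Fin 2) (Fin 2) E) - a • 1) 0 0
      (((S 1 γ : GL (Fin 2) E) : Matrix (Fin 2) (Fin 2) E) - a • 1)) := fun γ a => by
    rw [← blockDiag_smul_one e]
    exact blockDiag_sub e _ _ _ _
  have hsubD : ∀ γ : Γ, D γ - 1 = Matrix.reindex e e (Matrix.fromBlocks
      (((S 0 γ : GL (Fin 2) E) : Matrix (Fin 2) (Fin 2) E) - 1) 0 0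
      (((S 1 γ : GL (Fin 2) E) : Matrix (Fin 2) (Fin 2) E) - 1)) := fun γ => by
    have h1 := hsmulD γ 1
    simp only [one_smul] at h1
    exact h1
  have hDt1 : D τ₀ - 1 = Dt := hsubD τ₀
  have hT : T₀.map f = h.val * Dt * (h⁻¹).val := by
    rw [hT₀, Matrix.map_sub _ (map_sub f), hB, Matrix.map_one f (map_zero f) (map_one f),
      ← hDt1, Matrix.mul_sub, Matrix.sub_mul, Matrix.mul_one, Units.mul_inv]
  -- (1) `U = ker T₀` is a plane
  have hF1 : finrank F (LinearMap.ker T₀.mulVecLin) = 2 := by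
    rw [← finrank_ker_map_ringHom T₀ f, hT, finrank_ker_conj, hDt, finrank_ker_blockDiag, hS1 0,
      hS1 1]
  -- (2) `U` is stable under `A γ`
  have hF2 : ∀ γ, LinearMap.ker T₀.mulVecLin ≤
      LinearMap.ker (T₀ * ((A γ : GL (Fin 4) F) : Matrix (Fin 4) (Fin 4) F)).mulVecLin := by
    intro γ
    refine ker_le_ker_of_map _ _ f ?_
    have e2 : (T₀ * ((A γ : GL (Fin 4) F) : Matrix (Fin 4) (Fin 4) F)).map f =
        h.val * (Matrix.reindex e e (Matrix.fromBlocks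
          (N 0 * ((S 0 γ : GL (Fin 2) E) : Matrix (Fin 2) (Fin 2) E)) 0 0
          (N 1 * ((S 1 γ : GL (Fin 2) E) : Matrix (Fin 2) (Fin 2) E)))) * (h⁻¹).val := by
      rw [Matrix.map_mul, hT, hB, ← hmulD]
      simp only [Matrix.mul_assoc, Units.inv_mul_cancel_left]
    rw [e2, hT]
    exact ker_conj_le h (ker_blockDiag_le e (hS2 0 γ) (hS2 1 γ))
  -- (3) `A τ` is the identity on `U` for `τ ∈ I`
  have hF3 : ∀ τ ∈ I, LinearMap.ker T₀.mulVecLin ≤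
      LinearMap.ker (((A τ : GL (Fin 4) F) : Matrix (Fin 4) (Fin 4) F) - 1).mulVecLin := by
    intro τ hτ
    refine ker_le_ker_of_map _ _ f ?_
    have e3 : (((A τ : GL (Fin 4) F) : Matrix (Fin 4) (Fin 4) F) - 1).map f =
        h.val * (Matrix.reindex e e (Matrix.fromBlocks
          (((S 0 τ : GL (Fin 2) E) : Matrix (Fin 2) (Fin 2) E) - 1) 0 0
          (((S 1 τ : GL (Fin 2) E) : Matrix (Fin 2) (Fin 2) E) - 1))) * (h⁻¹).val := by
      rw [Matrix.map_sub _ (map_sub f), hB, Matrix.map_one f (map_zero f) (map_one f), ← hsubD,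
        Matrix.mul_sub, Matrix.sub_mul, Matrix.mul_one, Units.mul_inv]
    rw [e3, hT]
    exact ker_conj_le h (ker_blockDiag_le e (hS3 0 τ hτ) (hS3 1 τ hτ))
  -- (4) `A τ ≡ c τ` modulo `U` for `τ ∈ I`
  have hF4 : ∀ τ ∈ I,
      T₀ * (((A τ : GL (Fin 4) F) : Matrix (Fin 4) (Fin 4) F) - c τ • 1) = 0 := by
    intro τ hτ
    refine Matrix.map_injective f.injective ?_
    change (T₀ * (((A τ : GL (Fin 4) F) : Matrix (Fin 4) (Fin 4) F) - c τ • 1)).map f =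
      (0 : Matrix (Fin 4) (Fin 4) F).map f
    have e4 : (c τ • (1 : Matrix (Fin 4) (Fin 4) F)).map f =
        h.val * (f (c τ) • 1) * (h⁻¹).val := by
      rw [Matrix.map_smul' _ _ _ (map_mul f), Matrix.map_one f (map_zero f) (map_one f),
        Matrix.mul_smul, Matrix.mul_one, Matrix.smul_mul, Units.mul_inv]
    rw [Matrix.map_mul, hT, Matrix.map_sub _ (map_sub f), hB, e4, ← Matrix.sub_mul,
      ← Matrix.mul_sub, hsmulD, Matrix.map_zero f (map_zero f)]
    simp only [Matrix.mul_assoc, Units.inv_mul_cancel_left]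
    rw [← Matrix.mul_assoc Dt, hDt, blockDiag_mul, hS4 0 τ hτ, hS4 1 τ hτ, blockDiag_zero,
      Matrix.zero_mul, Matrix.mul_zero]
  -- the frame
  obtain ⟨g, hg1, hg2, hg3⟩ := exists_frame_of_plane (LinearMap.ker T₀.mulVecLin) hF1
  refine ⟨g, fun γ i j hi hj => ?_, fun τ hτ i j hi hj => ?_, fun τ hτ i j hi hj => ?_⟩
  · rw [Units.val_mul, Units.val_mul]
    refine hg1 _ (fun u hu => ?_) i j hi hj
    have hu' := hF2 γ hu
    rw [LinearMap.mem_ker, Matrix.mulVecLin_apply] at hu' ⊢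
    rwa [← Matrix.mulVec_mulVec] at hu'
  · rw [Units.val_mul, Units.val_mul]
    refine hg2 _ (fun u hu => ?_) i j hi hj
    have hu' := hF3 τ hτ hu
    rw [LinearMap.mem_ker, Matrix.mulVecLin_apply, Matrix.sub_mulVec, Matrix.one_mulVec,
      sub_eq_zero] at hu'
    exact hu'
  · rw [Units.val_mul, Units.val_mul]
    refine hg3 _ (c τ) (fun x => ?_) i j hi hj
    rw [LinearMap.mem_ker, Matrix.mulVecLin_apply]
    have hx : ((A τ : GL (Fin 4) F) : Matrix (Fin 4) (Fin 4) F) *ᵥ x - c τ • x =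
        (((A τ : GL (Fin 4) F) : Matrix (Fin 4) (Fin 4) F) - c τ • 1) *ᵥ x := by
      rw [Matrix.sub_mulVec, Matrix.smul_mulVec, Matrix.one_mulVec]
    rw [hx, Matrix.mulVec_mulVec, hF4 τ hτ, Matrix.zero_mulVec]

end Descent

end Summit.Langlands.Langlands.Cruxes.StableYoshidaCongruence.BurkhardtWeddleTwoThreeAnchor

end
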